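import Summits.ValiantsHypothesis.ValiantsHypothesis.Theorems.DefinabilityGapPivotRandom
import HarnessLib

/-!
# Definability gap, ROAD P: kill sums restricted to light cells — the good-line bound (N1 v2 (b))

`DefinabilityGapPivotRandom` bounds the FULL kill sum of a row or column of a curve's minor.  Step
(b) of the existence proof (NODE-v7 §H / PLAN-N1-v2) concedes the few medium cells of a GOOD
(non-crowded) line and controls only the kills on its LIGHT cells `S`.  This file restricts the
Bernstein dictionary to a cell subset:

* `rowKillOn S T c i c' a` (`≤ 2`), `colKillOn R T c j c' a` (`≤ 1`) — kills inflicted on the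
  cells of row `i` with column index in `S` (of column `j` with row index in `R`);
* dictionaries `card_deadCols_inter_le_sum_rowKillOn`, `card_killedRows_on_le_sum_colKillOn`;
* means by incidence `mean_rowKillOn_le` (`≤ p · Σ_{j ∈ S} #coCurves T c (i, j)`),
  `mean_colKillOn_le`; second moments `sum_sq_rowKillOn_le`, `sum_sq_colKillOn_le`;
* **the good-line bounds** `weight_rowLoadOn_le` / `weight_colLoadOn_le`: with point weights `≤ p`
  and restricted incidence `≤ I`, the assignments whose restricted kill sum reaches `p I + t`
  weigh at most `exp(−t²/(2(2pI + 2t/3)))` (rows) / `exp(−t²/(2(pI + t/3)))` (columns) under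
  `prodWeight w` — direct instances of `Literature.Probability.Moments.bernstein`.
-/

namespace Summit.ValiantsHypothesis.ValiantsHypothesis.Theorems.DefinabilityGapPivotGoodLines

open Finset Real
open Literature.Computability.AlgebraicComplexity Literature.Computability.MetaComplexity
open Literature.Probability.Moments
open Summit.ValiantsHypothesis.ValiantsHypothesis.Theorems.DefinabilityGapAffineRung
open Summit.ValiantsHypothesis.ValiantsHypothesis.Theorems.DefinabilityGapPivotCertificate
open Summit.ValiantsHypothesis.ValiantsHypothesis.Theorems.DefinabilityGapPivotLive
open Summit.ValiantsHypothesis.ValiantsHypothesis.Theorems.DefinabilityGapPivotAdmissible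
open Summit.ValiantsHypothesis.ValiantsHypothesis.Theorems.DefinabilityGapPivotRandom

variable {m : ℕ}

/-! ## Rows restricted to a set `S` of column indices -/

/-- Kills inflicted by `c'` (pivoting in row `a`) on the cells of row `i` of `S_c` whose column
index lies in `S`. [lens-5 g7] -/
noncomputable def rowKillOn (S : Finset (Fin m)) (T : Finset (Fin 3 → Fin (qOf m)))
    (c : Fin 3 → Fin (qOf m)) (i : Fin m) (c' : Fin 3 → Fin (qOf m)) (a : Fin m) : ℝ :=
  if c' ∈ T ∧ c' ≠ c ∧ a = i then
    ((S.filter fun j => cellEmb m c' (i, j) = cellEmb m c (i, j)).card : ℝ) else 0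

/-- `0 ≤ rowKillOn`. [lens-5 g7] -/
theorem rowKillOn_nonneg (S : Finset (Fin m)) (T : Finset (Fin 3 → Fin (qOf m)))
    (c : Fin 3 → Fin (qOf m)) (i : Fin m) (c' : Fin 3 → Fin (qOf m)) (a : Fin m) :
    0 ≤ rowKillOn S T c i c' a := by
  unfold rowKillOn
  split_ifs <;> positivity

/-- `rowKillOn ≤ 2`. [lens-5 g7] -/
theorem rowKillOn_le_two (S : Finset (Fin m)) (T : Finset (Fin 3 → Fin (qOf m)))
    (c : Fin 3 → Fin (qOf m)) (i : Fin m) (c' : Fin 3 → Fin (qOf m)) (a : Fin m) :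
    rowKillOn S T c i c' a ≤ 2 := by
  classical
  unfold rowKillOn
  split_ifs with h
  · have h1 : (S.filter fun j => cellEmb m c' (i, j) = cellEmb m c (i, j)).card ≤
        rowOverlap c c' i :=
      Finset.card_le_card (Finset.filter_subset_filter _ (Finset.subset_univ S))
    have h2 := rowOverlap_le_two h.2.1 i
    exact_mod_cast h1.trans h2
  · norm_num

/-- **Dictionary (rows, restricted)**: the killed cells of row `i ≠ r c` with column index in `S`
number at most `Σ_{c'} rowKillOn S T c i c' (r c')`. [lens-5 g7] -/
theorem card_deadCols_inter_le_sum_rowKillOn (S : Finset (Fin m))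
    (T : Finset (Fin 3 → Fin (qOf m))) (s₀ : Fin m) (r : (Fin 3 → Fin (qOf m)) → Fin m)
    (c : Fin 3 → Fin (qOf m)) {i : Fin m} (hi : i ≠ r c) :
    (((deadCols (pivotZeros m T s₀ r) c s₀ i) ∩ S).card : ℝ) ≤
      ∑ c' : Fin 3 → Fin (qOf m), rowKillOn S T c i c' (r c') := by
  classical
  set R := (Finset.univ : Finset (Fin 3 → Fin (qOf m))).filter
    fun c' => c' ∈ T ∧ c' ≠ c ∧ r c' = i with hR
  have hsub : deadCols (pivotZeros m T s₀ r) c s₀ i ∩ S ⊆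
      R.biUnion fun c' => S.filter fun j => cellEmb m c' (i, j) = cellEmb m c (i, j) := by
    intro j hj
    rw [Finset.mem_inter, mem_deadCols] at hj
    obtain ⟨c', hc'T, hc'c, hrc', heq⟩ := exists_of_mem_pivotZeros hi hj.1.2
    exact Finset.mem_biUnion.mpr
      ⟨c', Finset.mem_filter.mpr ⟨Finset.mem_univ _, hc'T, hc'c, hrc'⟩,
        Finset.mem_filter.mpr ⟨hj.2, heq⟩⟩
  have h1 : (deadCols (pivotZeros m T s₀ r) c s₀ i ∩ S).card ≤
      ∑ c' ∈ R, (S.filter fun j => cellEmb m c' (i, j) = cellEmb m c (i, j)).card :=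
    (Finset.card_le_card hsub).trans Finset.card_biUnion_le
  have h2 : ((∑ c' ∈ R, (S.filter fun j => cellEmb m c' (i, j) = cellEmb m c (i, j)).card : ℕ)
      : ℝ) = ∑ c' : Fin 3 → Fin (qOf m), rowKillOn S T c i c' (r c') := by
    rw [hR, Finset.sum_filter, Nat.cast_sum]
    refine Finset.sum_congr rfl fun c' _ => ?_
    unfold rowKillOn
    split_ifs <;> simp
  calc (((deadCols (pivotZeros m T s₀ r) c s₀ i) ∩ S).card : ℝ)
      ≤ ((∑ c' ∈ R, (S.filter fun j => cellEmb m c' (i, j) = cellEmb m c (i, j)).card : ℕ)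
          : ℝ) := by exact_mod_cast h1
    _ = _ := h2

/-- **Mean of the restricted row kill sum**: with point weights `≤ p` at row `i`, the mean is
`≤ p · Σ_{j ∈ S} #coCurves T c (i, j)`. [lens-5 g7] -/
theorem mean_rowKillOn_le (S : Finset (Fin m)) {w : (Fin 3 → Fin (qOf m)) → Fin m → ℝ}
    {p : ℝ} (hp : 0 ≤ p) (hwp : ∀ c', w c' ≤ fun _ => p)
    (T : Finset (Fin 3 → Fin (qOf m))) (c : Fin 3 → Fin (qOf m)) (i : Fin m) :
    ∑ c' : Fin 3 → Fin (qOf m), ∑ a : Fin m, w c' a * rowKillOn S T c i c' a ≤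
      p * ∑ j ∈ S, ((coCurves T c (i, j)).card : ℝ) := by
  classical
  -- pointwise in `c'`: the inner sum is `w c' i · #(S ∩ coincidences)` or `0`
  have hpt : ∀ c' : Fin 3 → Fin (qOf m), ∑ a : Fin m, w c' a * rowKillOn S T c i c' a ≤
      p * ∑ j ∈ S, (if c' ∈ coCurves T c (i, j) then (1 : ℝ) else 0) := by
    intro c'
    by_cases h : c' ∈ T ∧ c' ≠ c
    · rw [Finset.sum_eq_single i]
      · have hk : rowKillOn S T c i c' i =
            ∑ j ∈ S, (if c' ∈ coCurves T c (i, j) then (1 : ℝ) else 0) := by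
          unfold rowKillOn
          rw [if_pos ⟨h.1, h.2, rfl⟩, Finset.sum_boole]
          congr 2
          ext j
          simp [mem_coCurves, h.1, h.2]
        rw [hk]
        exact mul_le_mul_of_nonneg_right (hwp c' i)
          (Finset.sum_nonneg fun j _ => by positivity)
      · intro a _ ha
        simp [rowKillOn, ha]
      · simp
    · have hz : ∀ a, rowKillOn S T c i c' a = 0 := by
        intro a
        unfold rowKillOn
        rw [if_neg fun h' => h ⟨h'.1, h'.2.1⟩]
      simp only [hz, mul_zero, Finset.sum_const_zero]
      exact mul_nonneg hp (Finset.sum_nonneg fun j _ => by positivity)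
  calc ∑ c' : Fin 3 → Fin (qOf m), ∑ a : Fin m, w c' a * rowKillOn S T c i c' a
      ≤ ∑ c' : Fin 3 → Fin (qOf m),
          p * ∑ j ∈ S, (if c' ∈ coCurves T c (i, j) then (1 : ℝ) else 0) :=
        Finset.sum_le_sum fun c' _ => hpt c'
    _ = p * ∑ j ∈ S, ((coCurves T c (i, j)).card : ℝ) := by
        rw [← Finset.mul_sum, Finset.sum_comm]
        congr 1
        refine Finset.sum_congr rfl fun j _ => ?_
        rw [Finset.sum_boole, Finset.filter_univ_mem]

/-- Second moment of the restricted row kill sum `≤ 2 ·` mean. [lens-5 g7] -/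
theorem sum_sq_rowKillOn_le (S : Finset (Fin m)) (w : (Fin 3 → Fin (qOf m)) → Fin m → ℝ)
    (hw : ∀ c a, 0 ≤ w c a) (T : Finset (Fin 3 → Fin (qOf m))) (c : Fin 3 → Fin (qOf m))
    (i : Fin m) :
    ∑ c' : Fin 3 → Fin (qOf m), ∑ a : Fin m, w c' a * rowKillOn S T c i c' a ^ 2 ≤
      2 * ∑ c' : Fin 3 → Fin (qOf m), ∑ a : Fin m, w c' a * rowKillOn S T c i c' a := by
  rw [Finset.mul_sum]
  refine Finset.sum_le_sum fun c' _ => ?_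
  rw [Finset.mul_sum]
  refine Finset.sum_le_sum fun a _ => ?_
  have h0 := rowKillOn_nonneg S T c i c' a
  have h2 := rowKillOn_le_two S T c i c' a
  have hwa := hw c' a
  nlinarith [mul_nonneg hwa h0]

/-- **Good-row bound.**  Point weights `≤ p`, restricted incidence
`Σ_{j ∈ S} #coCurves T c (i, j) ≤ I` with `p I > 0`: the assignments whose restricted row kill
sum reaches `p I + t` have `prodWeight w`-weight `≤ exp(−t²/(2(2pI + 2t/3)))`. [lens-5 g7] -/
theorem weight_rowLoadOn_le (S : Finset (Fin m)) {w : (Fin 3 → Fin (qOf m)) → Fin m → ℝ}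
    (hw : ∀ c a, 0 ≤ w c a) (hw1 : ∀ c, ∑ a, w c a = 1) {p I t : ℝ} (hp : 0 ≤ p)
    (hwp : ∀ c', w c' ≤ fun _ => p) (T : Finset (Fin 3 → Fin (qOf m)))
    (c : Fin 3 → Fin (qOf m)) (i : Fin m)
    (hI : ∑ j ∈ S, ((coCurves T c (i, j)).card : ℝ) ≤ I) (hpI : 0 < p * I) (ht : 0 < t) :
    ∑ r ∈ (Finset.univ : Finset ((Fin 3 → Fin (qOf m)) → Fin m)).filter
        (fun r => p * I + t ≤ ∑ c', rowKillOn S T c i c' (r c')), prodWeight w r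
      ≤ exp (-(t ^ 2 / (2 * (2 * (p * I) + 2 * t / 3)))) := by
  classical
  have hμ : ∑ c' : Fin 3 → Fin (qOf m), ∑ a : Fin m, w c' a * rowKillOn S T c i c' a ≤
      p * I :=
    (mean_rowKillOn_le S hp hwp T c i).trans (mul_le_mul_of_nonneg_left hI hp)
  have hv : ∑ c' : Fin 3 → Fin (qOf m), ∑ a : Fin m, w c' a * rowKillOn S T c i c' a ^ 2 ≤
      2 * (p * I) :=
    (sum_sq_rowKillOn_le S w hw T c i).trans (by linarith)
  have hB := bernstein (ι := Fin 3 → Fin (qOf m)) (Γ := Fin m) hw hw1 (rowKillOn S T c i)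
    (b := 2) two_pos (fun c' a => rowKillOn_le_two S T c i c' a) (by positivity) hv ht
  refine le_trans (Finset.sum_le_sum_of_subset_of_nonneg ?_
    fun r _ _ => prodWeight_nonneg hw r) hB
  intro r hr
  rw [Finset.mem_filter] at hr ⊢
  refine ⟨Finset.mem_univ _, ?_⟩
  rw [Finset.sum_sub_distrib]
  linarith [hr.2]

/-! ## Columns restricted to a set `R` of row indices -/

/-- Kill inflicted by `c'` (pivoting in row `a ∈ R`) on the cell `(a, j)` of column `j` of `S_c`.
[lens-5 g7] -/
noncomputable def colKillOn (R : Finset (Fin m)) (T : Finset (Fin 3 → Fin (qOf m)))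
    (c : Fin 3 → Fin (qOf m)) (j : Fin m) (c' : Fin 3 → Fin (qOf m)) (a : Fin m) : ℝ :=
  if c' ∈ T ∧ c' ≠ c ∧ a ∈ R ∧ cellEmb m c' (a, j) = cellEmb m c (a, j) then 1 else 0

/-- `0 ≤ colKillOn`. [lens-5 g7] -/
theorem colKillOn_nonneg (R : Finset (Fin m)) (T : Finset (Fin 3 → Fin (qOf m)))
    (c : Fin 3 → Fin (qOf m)) (j : Fin m) (c' : Fin 3 → Fin (qOf m)) (a : Fin m) :
    0 ≤ colKillOn R T c j c' a := by
  unfold colKillOn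
  split_ifs <;> norm_num

/-- `colKillOn ≤ 1`. [lens-5 g7] -/
theorem colKillOn_le_one (R : Finset (Fin m)) (T : Finset (Fin 3 → Fin (qOf m)))
    (c : Fin 3 → Fin (qOf m)) (j : Fin m) (c' : Fin 3 → Fin (qOf m)) (a : Fin m) :
    colKillOn R T c j c' a ≤ 1 := by
  unfold colKillOn
  split_ifs <;> norm_num

/-- **Dictionary (columns, restricted)**: the killed cells `(i, j)` of column `j` of the minor of
`c` with `i ∈ R`, `i ≠ r c` number at most `Σ_{c'} colKillOn R T c j c' (r c')`. [lens-5 g7] -/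
theorem card_killedRows_on_le_sum_colKillOn (R : Finset (Fin m))
    (T : Finset (Fin 3 → Fin (qOf m))) (s₀ : Fin m) (r : (Fin 3 → Fin (qOf m)) → Fin m)
    (c : Fin 3 → Fin (qOf m)) (j : Fin m) :
    ((R.filter fun i => i ≠ r c ∧ cellEmb m c (i, j) ∈ pivotZeros m T s₀ r).card : ℝ) ≤
      ∑ c' : Fin 3 → Fin (qOf m), colKillOn R T c j c' (r c') := by
  classical
  set D := R.filter fun i => i ≠ r c ∧ cellEmb m c (i, j) ∈ pivotZeros m T s₀ r with hD
  set K := (Finset.univ : Finset (Fin 3 → Fin (qOf m))).filter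
    fun c' => c' ∈ T ∧ c' ≠ c ∧ r c' ∈ R ∧
      cellEmb m c' (r c', j) = cellEmb m c (r c', j) with hK
  have hcard : D.card ≤ K.card := by
    have key : ∀ i ∈ D, ∃ c' ∈ K, r c' = i := by
      intro i hi
      rw [hD, Finset.mem_filter] at hi
      obtain ⟨c', hc'T, hc'c, hrc', heq⟩ := exists_of_mem_pivotZeros hi.2.1 hi.2.2
      refine ⟨c', Finset.mem_filter.mpr ⟨Finset.mem_univ _, hc'T, hc'c, ?_, ?_⟩, hrc'⟩
      · rw [hrc']; exact hi.1
      · rw [hrc']; exact heq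
    calc D.card ≤ (K.image r).card := Finset.card_le_card fun i hi => by
            obtain ⟨c', hc', hrc'⟩ := key i hi
            exact Finset.mem_image.mpr ⟨c', hc', hrc'⟩
      _ ≤ K.card := Finset.card_image_le
  have h2 : (K.card : ℝ) = ∑ c' : Fin 3 → Fin (qOf m), colKillOn R T c j c' (r c') := by
    rw [hK, Finset.card_filter, Nat.cast_sum]
    refine Finset.sum_congr rfl fun c' _ => ?_
    unfold colKillOn
    split_ifs <;> simp
  calc (D.card : ℝ) ≤ (K.card : ℝ) := by exact_mod_cast hcard
    _ = _ := h2

/-- **Mean of the restricted column kill sum**: with all point weights `≤ p`, the mean is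
`≤ p · Σ_{a ∈ R} #coCurves T c (a, j)`. [lens-5 g7] -/
theorem mean_colKillOn_le (R : Finset (Fin m)) {w : (Fin 3 → Fin (qOf m)) → Fin m → ℝ}
    {p : ℝ} (hp : 0 ≤ p) (hwp : ∀ c', w c' ≤ fun _ => p)
    (T : Finset (Fin 3 → Fin (qOf m))) (c : Fin 3 → Fin (qOf m)) (j : Fin m) :
    ∑ c' : Fin 3 → Fin (qOf m), ∑ a : Fin m, w c' a * colKillOn R T c j c' a ≤
      p * ∑ a ∈ R, ((coCurves T c (a, j)).card : ℝ) := by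
  classical
  have hpt : ∀ (c' : Fin 3 → Fin (qOf m)) (a : Fin m), w c' a * colKillOn R T c j c' a ≤
      p * (if a ∈ R ∧ c' ∈ coCurves T c (a, j) then 1 else 0) := by
    intro c' a
    unfold colKillOn
    by_cases h : c' ∈ T ∧ c' ≠ c ∧ a ∈ R ∧ cellEmb m c' (a, j) = cellEmb m c (a, j)
    · rw [if_pos h, if_pos ⟨h.2.2.1, mem_coCurves.mpr ⟨h.1, h.2.1, h.2.2.2⟩⟩, mul_one,
        mul_one]
      exact hwp c' a
    · rw [if_neg h, mul_zero]
      split_ifs <;> positivity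
  calc ∑ c' : Fin 3 → Fin (qOf m), ∑ a : Fin m, w c' a * colKillOn R T c j c' a
      ≤ ∑ c' : Fin 3 → Fin (qOf m), ∑ a : Fin m,
          p * (if a ∈ R ∧ c' ∈ coCurves T c (a, j) then (1 : ℝ) else 0) :=
        Finset.sum_le_sum fun c' _ => Finset.sum_le_sum fun a _ => hpt c' a
    _ = p * ∑ a ∈ R, ((coCurves T c (a, j)).card : ℝ) := by
        rw [Finset.sum_comm, Finset.mul_sum]
        have hzero : ∀ a ∉ R, (∑ x : Fin 3 → Fin (qOf m),
            p * (if a ∈ R ∧ x ∈ coCurves T c (a, j) then (1 : ℝ) else 0)) = 0 := by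
          intro a ha
          refine Finset.sum_eq_zero fun c' _ => ?_
          simp [ha]
        rw [← Finset.sum_subset (Finset.subset_univ R) (fun a _ ha => hzero a ha)]
        refine Finset.sum_congr rfl fun a ha => ?_
        have hf : ((Finset.univ : Finset (Fin 3 → Fin (qOf m))).filter
            fun x => a ∈ R ∧ x ∈ coCurves T c (a, j)) = coCurves T c (a, j) := by
          ext c'
          simp [ha]
        rw [← Finset.mul_sum, Finset.sum_boole, hf]

/-- Second moment of the restricted column kill sum `≤` mean. [lens-5 g7] -/
theorem sum_sq_colKillOn_le (R : Finset (Fin m)) (w : (Fin 3 → Fin (qOf m)) → Fin m → ℝ)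
    (hw : ∀ c a, 0 ≤ w c a) (T : Finset (Fin 3 → Fin (qOf m))) (c : Fin 3 → Fin (qOf m))
    (j : Fin m) :
    ∑ c' : Fin 3 → Fin (qOf m), ∑ a : Fin m, w c' a * colKillOn R T c j c' a ^ 2 ≤
      ∑ c' : Fin 3 → Fin (qOf m), ∑ a : Fin m, w c' a * colKillOn R T c j c' a := by
  refine Finset.sum_le_sum fun c' _ => Finset.sum_le_sum fun a _ => ?_
  have h0 := colKillOn_nonneg R T c j c' a
  have h1 := colKillOn_le_one R T c j c' a
  have hwa := hw c' a
  nlinarith [mul_nonneg hwa h0]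

/-- **Good-column bound.**  Point weights `≤ p`, restricted incidence
`Σ_{a ∈ R} #coCurves T c (a, j) ≤ I` with `p I > 0`: the assignments whose restricted column
kill sum reaches `p I + t` weigh `≤ exp(−t²/(2(pI + t/3)))`. [lens-5 g7] -/
theorem weight_colLoadOn_le (R : Finset (Fin m)) {w : (Fin 3 → Fin (qOf m)) → Fin m → ℝ}
    (hw : ∀ c a, 0 ≤ w c a) (hw1 : ∀ c, ∑ a, w c a = 1) {p I t : ℝ} (hp : 0 ≤ p)
    (hwp : ∀ c', w c' ≤ fun _ => p) (T : Finset (Fin 3 → Fin (qOf m)))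
    (c : Fin 3 → Fin (qOf m)) (j : Fin m)
    (hI : ∑ a ∈ R, ((coCurves T c (a, j)).card : ℝ) ≤ I) (hpI : 0 < p * I) (ht : 0 < t) :
    ∑ r ∈ (Finset.univ : Finset ((Fin 3 → Fin (qOf m)) → Fin m)).filter
        (fun r => p * I + t ≤ ∑ c', colKillOn R T c j c' (r c')), prodWeight w r
      ≤ exp (-(t ^ 2 / (2 * (p * I + 1 * t / 3)))) := by
  classical
  have hμ : ∑ c' : Fin 3 → Fin (qOf m), ∑ a : Fin m, w c' a * colKillOn R T c j c' a ≤
      p * I :=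
    (mean_colKillOn_le R hp hwp T c j).trans (mul_le_mul_of_nonneg_left hI hp)
  have hv : ∑ c' : Fin 3 → Fin (qOf m), ∑ a : Fin m, w c' a * colKillOn R T c j c' a ^ 2 ≤
      p * I :=
    (sum_sq_colKillOn_le R w hw T c j).trans hμ
  have hB := bernstein (ι := Fin 3 → Fin (qOf m)) (Γ := Fin m) hw hw1 (colKillOn R T c j)
    (b := 1) one_pos (fun c' a => colKillOn_le_one R T c j c' a) hpI hv ht
  refine le_trans (Finset.sum_le_sum_of_subset_of_nonneg ?_
    fun r _ _ => prodWeight_nonneg hw r) hB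
  intro r hr
  rw [Finset.mem_filter] at hr ⊢
  refine ⟨Finset.mem_univ _, ?_⟩
  rw [Finset.sum_sub_distrib]
  linarith [hr.2]

end Summit.ValiantsHypothesis.ValiantsHypothesis.Theorems.DefinabilityGapPivotGoodLines
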